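import Summits.AnomalousDissipation.AnomalousDissipation.Theorems.MomentLadder.Negative.Clauses
import Literature.Analysis.FunctionSpaces.TorusEnstrophyTrilinear
import Literature.Analysis.FunctionSpaces.TorusTruncationH1
import Literature.Analysis.FluidPDE.ZerothLaw

/-!
# UI ⇒ N-uniform resolution: stub `stub_uiResolution` of line `Sketch`
# (crux `MomentParity.MomentLadder`, stmt-AnomalousDissipation-11463)

Stub A3 of the skeleton: from the spectral tail bound (A1)
`Z u ≤ Z(P_K u) + ‖Δu‖² / (4π²(K²+1))` and the `N`-uniform weighted palinstrophy bound (A2)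
`∫ ‖Δu‖² / (1+Z)² dμ ≤ C(f,ν,R)`, ONE schedule `κ = κ(f,ν,R,ω)` resolves every admissible level-`N` law
whose enstrophy `Z = ‖∇u‖²` has uniform-integrability modulus `ω` (`∫_{Z > M} Z dμ ≤ ω M`, `ω → 0`).

Proof (Chebyshev splitting): for the `n`-th budget `(n+1)⁻¹ = (n+1)⁻¹/2 + (n+1)⁻¹/2` pick `M n` with
`ω (M n) ≤ (n+1)⁻¹/2` and `κ n` with `(1 + M n)² C / (4π²(κ n² + 1)) ≤ (n+1)⁻¹/2`; pointwise
`Z ≤ Z ∘ P_{κ n} + c_{κ n} (1 + M n)² ‖Δu‖²/(1+Z)² + 1_{Z > M n} Z` (A1 on `{Z ≤ M n}`), then integrate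
(the last two summands are measurable on `H`: the spectral palinstrophy is a countable sum of continuous
functions of `u ∈ H`, like `Torus.measurable_eGradNormSq_coe`).
-/

set_option linter.dupNamespace false

noncomputable section

namespace Summit.AnomalousDissipation.AnomalousDissipation.Theorems.MomentLadder

open MeasureTheory Filter Topology Set
open scoped ENNReal NNReal InnerProductSpace RealInnerProductSpace Polynomial
open Literature.Analysis.FunctionSpaces Literature.Analysis.FluidPDE
open Summit.AnomalousDissipation.AnomalousDissipation.Theses.MomentParity
open Summit.AnomalousDissipation.AnomalousDissipation.Theorems.QuarticGate.Negative
open Summit.AnomalousDissipation.AnomalousDissipation.Theorems.MomentLadder.Negative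

/-- Local notation for the energy space `H = L²_σ(T³)` (a submodule, coerced to a type where needed). -/
local notation "H3" => Torus.energySpace (Fin 3)

/-- Local notation for the torus `T³`. -/
local notation "T3" => UnitAddTorus (Fin 3)

/-- Local notation for `ℝ³`. -/
local notation "R3" => EuclideanSpace ℝ (Fin 3)

/-! ## Measurability of the spectral palinstrophy on `H` -/

/-- The spectral palinstrophy `u ↦ ‖Δu‖₂² = 16π⁴ ∑ₖ |k|⁴ ‖û(k)‖²` (`eLaplacianNormSq` of the representative
of `u ∈ H`) is Borel measurable on `H`: a countable sum of continuous functions of `u` (each Fourier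
coefficient is continuous on `L²`, `Torus.continuous_mFourierCoeff_complexify_coe`). [folklore] -/
theorem measurable_eLaplacianNormSq_coe :
    Measurable fun u : H3 => eLaplacianNormSq (u.1 : T3 → R3) := by
  have h : (fun u : H3 => eLaplacianNormSq (u.1 : T3 → R3)) = fun u : H3 =>
      ENNReal.ofReal (16 * Real.pi ^ 4) * ∑' k : Fin 3 → ℤ,
        (if k = 0 then 0 else ENNReal.ofReal (Torus.freqNormSq k ^ (2 : ℝ))) *
          ‖UnitAddTorus.mFourierCoeff (EuclideanSpace.complexify ∘ (u.1 : T3 → R3)) k‖ₑ ^ 2 := by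
    funext u
    rw [eLaplacianNormSq, Torus.eHomSobolevSeminorm, ENNReal.rpow_half_sq]
  rw [h]
  refine Measurable.const_mul (Measurable.tsum fun k => Measurable.const_mul ?_ _) _
  exact ((Torus.continuous_mFourierCoeff_complexify_coe k).comp
    continuous_subtype_val).measurable.enorm.pow_const 2

/-! ## Choice of the cutoff: the tail coefficient `(4π²(K²+1))⁻¹` beats any finite constant -/

/-- For `D < ∞` and `ε > 0` there is a cutoff `K` with `D / (4π²(K²+1)) ≤ ε` (explicitly any
`K > D/ε`, since `K ≤ 4π²(K²+1)`). [folklore] -/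
theorem exists_tailCoeff_mul_le {D ε : ℝ≥0∞} (hD : D ≠ ⊤) (hε : ε ≠ 0) :
    ∃ K : ℕ, (ENNReal.ofReal (4 * Real.pi ^ 2 * ((K : ℝ) ^ 2 + 1)))⁻¹ * D ≤ ε := by
  obtain ⟨K, hK⟩ := ENNReal.exists_nat_gt (ENNReal.div_lt_top hD hε).ne
  refine ⟨K, ?_⟩
  have hK0 : (K : ℝ≥0∞) ≠ 0 := (lt_of_le_of_lt (zero_le (a := D / ε)) hK).ne'
  have hKle : (K : ℝ≥0∞) ≤ ENNReal.ofReal (4 * Real.pi ^ 2 * ((K : ℝ) ^ 2 + 1)) := by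
    rw [← ENNReal.ofReal_natCast]
    refine ENNReal.ofReal_le_ofReal ?_
    have hπ : (1 : ℝ) ≤ Real.pi ^ 2 := by nlinarith [Real.pi_gt_three]
    have hK2 : (K : ℝ) ≤ (K : ℝ) ^ 2 + 1 := by nlinarith [sq_nonneg ((K : ℝ) - 1)]
    have hK0' : (0 : ℝ) ≤ (K : ℝ) ^ 2 + 1 := by positivity
    nlinarith
  have hDlt : D < K * ε := (ENNReal.div_lt_iff (Or.inl hε) (Or.inr hD)).1 hK
  calc (ENNReal.ofReal (4 * Real.pi ^ 2 * ((K : ℝ) ^ 2 + 1)))⁻¹ * D ≤ (K : ℝ≥0∞)⁻¹ * D :=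
        mul_le_mul' (ENNReal.inv_le_inv.2 hKle) le_rfl
    _ ≤ (K : ℝ≥0∞)⁻¹ * (K * ε) := mul_le_mul' le_rfl hDlt.le
    _ = ε := by rw [← mul_assoc, ENNReal.inv_mul_cancel hK0 (ENNReal.natCast_ne_top K), one_mul]

/-! ## The Chebyshev splitting -/

/-- Pointwise splitting at level `M` with cutoff `K`: for every `u ∈ H`,
`Z u ≤ Z(P_K u) + c_K (1+M)² ‖Δu‖²/(1+Z u)² + 1_{Z > M}(u) Z u`, where `c_K = (4π²(K²+1))⁻¹`.
On `{Z ≤ M}` this is the tail bound (A1) and `‖Δu‖² = (1+Z)² · ‖Δu‖²/(1+Z)² ≤ (1+M)² ‖Δu‖²/(1+Z)²`;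
on `{Z > M}` it is trivial. [folklore] -/
theorem eGradNormSq_le_split
    (hT : ∀ (K : ℕ) (v : T3 → R3), Integrable v volume →
      Torus.eGradNormSq v ≤ Torus.eGradNormSq (Torus.fourierTruncate K v) +
        (ENNReal.ofReal (4 * Real.pi ^ 2 * ((K : ℝ) ^ 2 + 1)))⁻¹ * eLaplacianNormSq v)
    (K M : ℕ) (u : H3) :
    Torus.eGradNormSq (u.1 : T3 → R3) ≤
      Torus.eGradNormSq (Torus.fourierTruncate K (u.1 : T3 → R3)) +
        ((ENNReal.ofReal (4 * Real.pi ^ 2 * ((K : ℝ) ^ 2 + 1)))⁻¹ * (1 + (M : ℝ≥0∞)) ^ 2 *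
            (eLaplacianNormSq (u.1 : T3 → R3) / (1 + Torus.eGradNormSq (u.1 : T3 → R3)) ^ 2) +
          {u : H3 | (M : ℝ≥0∞) < Torus.eGradNormSq (u.1 : T3 → R3)}.indicator
            (fun u : H3 => Torus.eGradNormSq (u.1 : T3 → R3)) u) := by
  by_cases hu : (M : ℝ≥0∞) < Torus.eGradNormSq (u.1 : T3 → R3)
  · have hmem : u ∈ {u : H3 | (M : ℝ≥0∞) < Torus.eGradNormSq (u.1 : T3 → R3)} := hu
    rw [indicator_of_mem hmem]
    exact le_add_self.trans le_add_self
  · rw [not_lt] at hu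
    have hint : Integrable (u.1 : T3 → R3) volume := (Lp.memLp u.1).integrable one_le_two
    have hZT : Torus.eGradNormSq (u.1 : T3 → R3) ≠ ⊤ := ne_top_of_le_ne_top (ENNReal.natCast_ne_top M) hu
    have hA0 : (1 + Torus.eGradNormSq (u.1 : T3 → R3)) ^ 2 ≠ 0 := pow_ne_zero _ (by simp)
    have hAT : (1 + Torus.eGradNormSq (u.1 : T3 → R3)) ^ 2 ≠ ⊤ :=
      ENNReal.pow_ne_top (ENNReal.add_ne_top.2 ⟨ENNReal.one_ne_top, hZT⟩)
    have hPal : eLaplacianNormSq (u.1 : T3 → R3) ≤ (1 + (M : ℝ≥0∞)) ^ 2 *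
        (eLaplacianNormSq (u.1 : T3 → R3) / (1 + Torus.eGradNormSq (u.1 : T3 → R3)) ^ 2) := by
      calc eLaplacianNormSq (u.1 : T3 → R3) = (1 + Torus.eGradNormSq (u.1 : T3 → R3)) ^ 2 *
            (eLaplacianNormSq (u.1 : T3 → R3) / (1 + Torus.eGradNormSq (u.1 : T3 → R3)) ^ 2) :=
            (ENNReal.mul_div_cancel hA0 hAT).symm
        _ ≤ (1 + (M : ℝ≥0∞)) ^ 2 *
            (eLaplacianNormSq (u.1 : T3 → R3) / (1 + Torus.eGradNormSq (u.1 : T3 → R3)) ^ 2) :=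
            mul_le_mul' (pow_le_pow_left' (add_le_add le_rfl hu) 2) le_rfl
    calc Torus.eGradNormSq (u.1 : T3 → R3) ≤ Torus.eGradNormSq (Torus.fourierTruncate K (u.1 : T3 → R3)) +
          (ENNReal.ofReal (4 * Real.pi ^ 2 * ((K : ℝ) ^ 2 + 1)))⁻¹ * eLaplacianNormSq (u.1 : T3 → R3) :=
          hT K _ hint
      _ ≤ Torus.eGradNormSq (Torus.fourierTruncate K (u.1 : T3 → R3)) +
          (ENNReal.ofReal (4 * Real.pi ^ 2 * ((K : ℝ) ^ 2 + 1)))⁻¹ * ((1 + (M : ℝ≥0∞)) ^ 2 *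
            (eLaplacianNormSq (u.1 : T3 → R3) / (1 + Torus.eGradNormSq (u.1 : T3 → R3)) ^ 2)) :=
          add_le_add le_rfl (mul_le_mul' le_rfl hPal)
      _ = Torus.eGradNormSq (Torus.fourierTruncate K (u.1 : T3 → R3)) +
          (ENNReal.ofReal (4 * Real.pi ^ 2 * ((K : ℝ) ^ 2 + 1)))⁻¹ * (1 + (M : ℝ≥0∞)) ^ 2 *
            (eLaplacianNormSq (u.1 : T3 → R3) / (1 + Torus.eGradNormSq (u.1 : T3 → R3)) ^ 2) := by
          ring
      _ ≤ _ := add_le_add le_rfl le_self_add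

/-- Integrated splitting at level `M` with cutoff `K`: for every law `μ` on `H` whose weighted
palinstrophy is at most `C`,
`∫ Z dμ ≤ ∫ Z(P_K u) dμ + (c_K (1+M)² C + ∫_{Z > M} Z dμ)`. [folklore] -/
theorem lintegral_eGradNormSq_le_split
    (hT : ∀ (K : ℕ) (v : T3 → R3), Integrable v volume →
      Torus.eGradNormSq v ≤ Torus.eGradNormSq (Torus.fourierTruncate K v) +
        (ENNReal.ofReal (4 * Real.pi ^ 2 * ((K : ℝ) ^ 2 + 1)))⁻¹ * eLaplacianNormSq v)
    (K M : ℕ) {C : ℝ≥0∞} (μ : Measure H3)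
    (hW : ∫⁻ u, eLaplacianNormSq (u.1 : T3 → R3) / (1 + Torus.eGradNormSq (u.1 : T3 → R3)) ^ 2 ∂μ ≤ C) :
    ∫⁻ u, Torus.eGradNormSq (u.1 : T3 → R3) ∂μ ≤
      (∫⁻ u, Torus.eGradNormSq (Torus.fourierTruncate K (u.1 : T3 → R3)) ∂μ) +
        ((ENNReal.ofReal (4 * Real.pi ^ 2 * ((K : ℝ) ^ 2 + 1)))⁻¹ * ((1 + (M : ℝ≥0∞)) ^ 2 * C) +
          ∫⁻ u in {u : H3 | (M : ℝ≥0∞) < Torus.eGradNormSq (u.1 : T3 → R3)},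
            Torus.eGradNormSq (u.1 : T3 → R3) ∂μ) := by
  set Z : H3 → ℝ≥0∞ := fun u => Torus.eGradNormSq (u.1 : T3 → R3) with hZ
  set Pal : H3 → ℝ≥0∞ := fun u => eLaplacianNormSq (u.1 : T3 → R3) with hPal
  set c : ℝ≥0∞ := (ENNReal.ofReal (4 * Real.pi ^ 2 * ((K : ℝ) ^ 2 + 1)))⁻¹ with hc
  have hZm : Measurable Z := Torus.measurable_eGradNormSq_coe
  have hPalm : Measurable Pal := measurable_eLaplacianNormSq_coe
  have hS : MeasurableSet {u : H3 | (M : ℝ≥0∞) < Z u} := measurableSet_lt measurable_const hZm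
  have hQm : Measurable fun u => Pal u / (1 + Z u) ^ 2 := hPalm.div ((hZm.const_add 1).pow_const 2)
  have hWm : Measurable fun u => c * (1 + (M : ℝ≥0∞)) ^ 2 * (Pal u / (1 + Z u) ^ 2) := hQm.const_mul _
  have hIm : Measurable ({u : H3 | (M : ℝ≥0∞) < Z u}.indicator Z) := hZm.indicator hS
  have hWC : ∫⁻ u, Pal u / (1 + Z u) ^ 2 ∂μ ≤ C := hW
  change ∫⁻ u, Z u ∂μ ≤ (∫⁻ u, Torus.eGradNormSq (Torus.fourierTruncate K (u.1 : T3 → R3)) ∂μ) +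
    (c * ((1 + (M : ℝ≥0∞)) ^ 2 * C) + ∫⁻ u in {u : H3 | (M : ℝ≥0∞) < Z u}, Z u ∂μ)
  calc ∫⁻ u, Z u ∂μ ≤ ∫⁻ u, Torus.eGradNormSq (Torus.fourierTruncate K (u.1 : T3 → R3)) +
        (c * (1 + (M : ℝ≥0∞)) ^ 2 * (Pal u / (1 + Z u) ^ 2) +
          {u : H3 | (M : ℝ≥0∞) < Z u}.indicator Z u) ∂μ :=
        lintegral_mono fun u => eGradNormSq_le_split hT K M u
    _ = (∫⁻ u, Torus.eGradNormSq (Torus.fourierTruncate K (u.1 : T3 → R3)) ∂μ) +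
        ∫⁻ u, (c * (1 + (M : ℝ≥0∞)) ^ 2 * (Pal u / (1 + Z u) ^ 2) +
          {u : H3 | (M : ℝ≥0∞) < Z u}.indicator Z u) ∂μ :=
        lintegral_add_right _ (hWm.add hIm)
    _ = (∫⁻ u, Torus.eGradNormSq (Torus.fourierTruncate K (u.1 : T3 → R3)) ∂μ) +
        (c * (1 + (M : ℝ≥0∞)) ^ 2 * (∫⁻ u, Pal u / (1 + Z u) ^ 2 ∂μ) +
          ∫⁻ u in {u : H3 | (M : ℝ≥0∞) < Z u}, Z u ∂μ) := by
        rw [lintegral_add_right _ hIm, lintegral_const_mul _ hQm, lintegral_indicator hS]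
    _ ≤ (∫⁻ u, Torus.eGradNormSq (Torus.fourierTruncate K (u.1 : T3 → R3)) ∂μ) +
        (c * ((1 + (M : ℝ≥0∞)) ^ 2 * C) + ∫⁻ u in {u : H3 | (M : ℝ≥0∞) < Z u}, Z u ∂μ) := by
        rw [mul_assoc]
        exact add_le_add le_rfl (add_le_add (mul_le_mul' le_rfl (mul_le_mul' le_rfl hWC)) le_rfl)

/-! ## The stub -/

/-- **A3: UI ⇒ N-uniform resolution.** From the tail bound (A1) and the `N`-uniform weighted palinstrophy
bound (A2), for every smooth force `f`, viscosity `ν > 0`, radius `R` and UI-modulus `ω → 0` there is ONE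
schedule `κ = κ(f,ν,R,ω)` such that every admissible level-`N` law in the ball (probability, level-`N`
carried, supported in `‖u‖ ≤ R`, polynomially stationary at every degree) with `∫_{Z > M} Z dμ ≤ ω M`
for all `M` is `κ`-resolved. Chebyshev splitting: `eGradNormSq_le_split`, `lintegral_eGradNormSq_le_split`,
`exists_tailCoeff_mul_le`. [folklore] -/
theorem stub_uiResolution :
    (∀ (K : ℕ) (v : UnitAddTorus (Fin 3) → EuclideanSpace ℝ (Fin 3)), Integrable v volume →
      Torus.eGradNormSq v ≤ Torus.eGradNormSq (Torus.fourierTruncate K v) +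
        (ENNReal.ofReal (4 * Real.pi ^ 2 * ((K : ℝ) ^ 2 + 1)))⁻¹ * eLaplacianNormSq v) →
    (∀ (f : UnitAddTorus (Fin 3) → EuclideanSpace ℝ (Fin 3)), Torus.IsSmooth f → ∀ (ν : ℝ), 0 < ν → ∀ (R : ℝ),
      ∃ C : ℝ≥0∞, C < ⊤ ∧ ∀ (N : ℕ) (μ : Measure (Torus.energySpace (Fin 3))), IsProbabilityMeasure μ →
        (∀ᵐ u ∂μ, IsLevel N u) → IsSupported R μ → (∀ d, IsPolyStationary ν f N d μ) →
        ∫⁻ u, eLaplacianNormSq (u.1 : UnitAddTorus (Fin 3) → EuclideanSpace ℝ (Fin 3)) /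
            (1 + Torus.eGradNormSq (u.1 : UnitAddTorus (Fin 3) → EuclideanSpace ℝ (Fin 3))) ^ 2 ∂μ ≤ C) →
    ∀ (f : UnitAddTorus (Fin 3) → EuclideanSpace ℝ (Fin 3)), Torus.IsSmooth f → ∀ (ν : ℝ), 0 < ν →
      ∀ (R : ℝ) (ω : ℕ → ℝ≥0∞), Tendsto ω atTop (𝓝 0) →
      ∃ κ : ℕ → ℕ, ∀ (N : ℕ) (μ : Measure (Torus.energySpace (Fin 3))), IsProbabilityMeasure μ →
        (∀ᵐ u ∂μ, IsLevel N u) → IsSupported R μ → (∀ d, IsPolyStationary ν f N d μ) →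
        (∀ M : ℕ, ∫⁻ u in {u : Torus.energySpace (Fin 3) |
            (M : ℝ≥0∞) < Torus.eGradNormSq (u.1 : UnitAddTorus (Fin 3) → EuclideanSpace ℝ (Fin 3))},
            Torus.eGradNormSq (u.1 : UnitAddTorus (Fin 3) → EuclideanSpace ℝ (Fin 3)) ∂μ ≤ ω M) →
        IsResolved κ μ := by
  intro hT hW f hf ν hν R ω hω
  obtain ⟨C, hCT, hC⟩ := hW f hf ν hν R
  -- the half-budgets `ε n = (n+1)⁻¹ / 2 > 0`
  set ε : ℕ → ℝ≥0∞ := fun n => ((n : ℝ≥0∞) + 1)⁻¹ / 2 with hε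
  have hε0 : ∀ n, ε n ≠ 0 := fun n => by
    rw [hε]
    exact (ENNReal.div_pos_iff.2 ⟨ENNReal.inv_ne_zero.2
      (ENNReal.add_ne_top.2 ⟨ENNReal.natCast_ne_top n, ENNReal.one_ne_top⟩), ENNReal.ofNat_ne_top⟩).ne'
  -- the Chebyshev level `M n`: `ω (M n) ≤ ε n`
  have hM' : ∀ n, ∃ m : ℕ, ω m ≤ ε n := fun n => by
    obtain ⟨m, hm⟩ := ENNReal.tendsto_atTop_zero.1 hω (ε n) (pos_iff_ne_zero.2 (hε0 n))
    exact ⟨m, hm m le_rfl⟩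
  choose M hM using hM'
  -- the cutoff `κ n`: `c_{κ n} (1 + M n)² C ≤ ε n`
  have hK' : ∀ n, ∃ K : ℕ, (ENNReal.ofReal (4 * Real.pi ^ 2 * ((K : ℝ) ^ 2 + 1)))⁻¹ *
      ((1 + ((M n : ℕ) : ℝ≥0∞)) ^ 2 * C) ≤ ε n := fun n =>
    exists_tailCoeff_mul_le (ENNReal.mul_ne_top (ENNReal.pow_ne_top
      (ENNReal.add_ne_top.2 ⟨ENNReal.one_ne_top, ENNReal.natCast_ne_top (M n)⟩)) hCT.ne) (hε0 n)
  choose κ hκ using hK'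
  refine ⟨κ, fun N μ hP hlev hsupp hstat hUI n => ?_⟩
  have hWμ := hC N μ hP hlev hsupp hstat
  calc ∫⁻ u, Torus.eGradNormSq (u.1 : UnitAddTorus (Fin 3) → EuclideanSpace ℝ (Fin 3)) ∂μ
      ≤ (∫⁻ u, Torus.eGradNormSq (Torus.fourierTruncate (κ n)
            (u.1 : UnitAddTorus (Fin 3) → EuclideanSpace ℝ (Fin 3))) ∂μ) +
          ((ENNReal.ofReal (4 * Real.pi ^ 2 * ((κ n : ℝ) ^ 2 + 1)))⁻¹ * ((1 + ((M n : ℕ) : ℝ≥0∞)) ^ 2 * C) +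
            ∫⁻ u in {u : H3 | ((M n : ℕ) : ℝ≥0∞) < Torus.eGradNormSq (u.1 : T3 → R3)},
              Torus.eGradNormSq (u.1 : T3 → R3) ∂μ) :=
        lintegral_eGradNormSq_le_split hT (κ n) (M n) μ hWμ
    _ ≤ (∫⁻ u, Torus.eGradNormSq (Torus.fourierTruncate (κ n)
            (u.1 : UnitAddTorus (Fin 3) → EuclideanSpace ℝ (Fin 3))) ∂μ) + (ε n + ε n) :=
        add_le_add le_rfl (add_le_add (hκ n) ((hUI (M n)).trans (hM n)))
    _ = (∫⁻ u, Torus.eGradNormSq (Torus.fourierTruncate (κ n)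
            (u.1 : UnitAddTorus (Fin 3) → EuclideanSpace ℝ (Fin 3))) ∂μ) + ((n : ℝ≥0∞) + 1)⁻¹ := by
        rw [hε, ENNReal.add_halves]

end Summit.AnomalousDissipation.AnomalousDissipation.Theorems.MomentLadder

end
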